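/-
Copyright (c) 2026. Released under Apache 2.0 license.

# CDT Theorem 1.0.1, holonomic side: integrality of the `q`-expansion of `(λ/16)^{2m} F/Δᵐ`

For `F ∈ M_{12m}(G)` (`G ∋ T^{2N}`) with integral Fourier coefficients at the period `2N`, the
function `h := (λ/16)^{2m} · F/Δᵐ` has an INTEGRAL power-series expansion in `q_{2N} = e^{πiτ/N}`:
`Δ = q(1 - 24q + ⋯)` is `q` times a unit of `ℤ⟦q⟧` and `λ/16 = q₂(1 - 8q₂ + ⋯)` is `q₂ = e^{πiτ}` times
a unit, so the factor `(λ/16)^{2m}` exactly cancels the pole of `1/Δᵐ` at the cusp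
[CalegariDimitrovTang2025, §6.3, proof of Theorem 1.0.1, with Lemma 4.2.2].  On the way we record two
generic facts on `q`-expansions of periodic holomorphic functions bounded at `i∞`: the expansion at
the period `N·h` is the `N`-fold expansion (`q ↦ q^N`) of the expansion at the period `h`, and
`q`-expansions are multiplicative on powers.
-/
import Literature.NumberTheory.Automorphic.UnboundedDenominatorsGeneratorAnalytic
import Literature.NumberTheory.Automorphic.GammaTwoModularFormsBasis
import HarnessLib

open Complex Real Filter Topology Function Metric Set Asymptotics
open UpperHalfPlane hiding I
open scoped Real Topology Manifold MatrixGroups ModularForm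

namespace Literature.NumberTheory.Automorphic

namespace UnboundedDenominators

open _root_.Complex Literature.NumberTheory.Automorphic.ModularLambda ModularGroup
  CongruenceSubgroup Matrix.SpecialLinearGroup Literature.Analysis.Complex

/-! ### Generic facts on `q`-expansions -/

/-- The Taylor series of the cusp function at `0` is Mathlib's `qExpansion`.
[cite: DiamondShurman2005, §1.1 p. 3] -/
theorem taylorSeries_cuspFunction_eq_qExpansion (h : ℝ) (f : ℍ → ℂ) :
    (PowerSeries.mk fun n ↦ iteratedDeriv n (cuspFunction h f) 0 / n.factorial) =
      qExpansion h f := by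
  ext n
  rw [PowerSeries.coeff_mk, qExpansion_coeff, div_eq_inv_mul]

/-- **Change of period**: for an `h`-periodic holomorphic function `f` on `ℍ` bounded at `i∞`, the
`q`-expansion at the period `N·h` is obtained from the one at the period `h` by `q ↦ q^N`
(`q_{Nh}^N = q_h`). [cite: DiamondShurman2005, §1.2 p. 17] -/
theorem qExpansion_natCast_mul_eq_expand {h : ℝ} (hh : 0 < h) {N : ℕ} (hN : N ≠ 0) {f : ℍ → ℂ}
    (hfper : Periodic (f ∘ ofComplex) h) (hfhol : MDiff f) (hfbdd : IsBoundedAtImInfty f) :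
    qExpansion ((N : ℝ) * h) f = PowerSeries.expand N hN (qExpansion h f) := by
  have hNpos : 0 < N := Nat.pos_of_ne_zero hN
  have hNh : 0 < (N : ℝ) * h := mul_pos (by exact_mod_cast hNpos) hh
  have hperN : Periodic (f ∘ ofComplex) (((N : ℝ) * h : ℝ) : ℂ) := by
    rw [Complex.ofReal_mul, Complex.ofReal_natCast]
    exact hfper.nat_mul N
  -- bundle `f` as a continuous map to use Mathlib's uniqueness of `q`-expansion coefficients
  set f' : C(ℍ, ℂ) := ⟨f, hfhol.continuous⟩ with hf'def
  have hf' : (f' : ℍ → ℂ) = f := rfl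
  ext k
  symm
  rw [← hf']
  refine qExpansion_coeff_unique
    (c := fun k ↦ PowerSeries.coeff k (PowerSeries.expand N hN (qExpansion h f'))) f' hNh
    (analyticAt_cuspFunction_zero hNh hperN hfhol hfbdd) (fun τ ↦ ?_) k
  rw [hf']
  have hinj : Function.Injective (fun m : ℕ ↦ N * m) := mul_right_injective₀ hN
  have hq : Periodic.qParam ((N : ℝ) * h) τ ^ N = Periodic.qParam h τ := by
    simp only [Periodic.qParam, ← Complex.exp_nat_mul]
    congr 1
    have hN' : (N : ℂ) ≠ 0 := by exact_mod_cast hN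
    push_cast
    field_simp
  rw [← hinj.hasSum_iff]
  · convert hasSum_qExpansion hh hfper hfhol hfbdd τ using 1
    funext m
    simp only [Function.comp_apply, PowerSeries.coeff_expand_mul, pow_mul, hq]
  · intro k hk
    have hk' : ¬ N ∣ k := by
      rintro ⟨m, rfl⟩
      exact hk ⟨m, rfl⟩
    simp only [PowerSeries.coeff_expand_of_not_dvd N hN _ hk', zero_smul]

/-- Powers of an `h`-periodic function are `h`-periodic. [cite: DiamondShurman2005, §1.1 p. 3] -/
theorem periodic_pow_comp_ofComplex {f : ℍ → ℂ} {h : ℝ} (hf : Periodic (f ∘ ofComplex) h)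
    (l : ℕ) : Periodic ((f ^ l) ∘ ofComplex) h := fun x ↦ by
  simpa only [Function.comp_apply, Pi.pow_apply] using congrArg (· ^ l) (hf x)

/-- **`q`-expansions are multiplicative on powers** of a periodic holomorphic function bounded at
`i∞` (the `q`-expansion is a ring homomorphism). [cite: DiamondShurman2005, §1.1 p. 3] -/
theorem qExpansion_pow {h : ℝ} (hh : 0 < h) {f : ℍ → ℂ} (hfper : Periodic (f ∘ ofComplex) h)
    (hfhol : MDiff f) (hfbdd : IsBoundedAtImInfty f) (l : ℕ) :
    qExpansion h (f ^ l) = qExpansion h f ^ l := by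
  induction l with
  | zero => simp [qExpansion_one]
  | succ l ih =>
    rw [pow_succ, pow_succ, qExpansion_mul, ih]
    · exact analyticAt_cuspFunction_zero hh (periodic_pow_comp_ofComplex hfper l) (hfhol.pow l)
        (isBoundedAtImInfty_pow hfbdd l)
    · exact analyticAt_cuspFunction_zero hh hfper hfhol hfbdd


/-! ### The expansion of `(λ/16)^{2m} F/Δᵐ` at the period `2N` is integral -/

variable {G : Subgroup SL(2, ℤ)} {m : ℕ}

/-- `λ/16` is `2N`-periodic for every `N` (`λ(τ + 2) = λ(τ)`). [cite: CalegariDimitrovTang2025, §1 p. 3] -/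
theorem periodic_modularLambda_div_sixteen_two_mul (N : ℕ) :
    Periodic ((fun τ : ℍ ↦ modularLambda τ / 16) ∘ ofComplex) (((2 * N : ℕ) : ℝ) : ℂ) := by
  have h := periodic_modularLambda_div_sixteen.nat_mul N
  have e : ((N : ℂ)) * ((2 : ℝ) : ℂ) = ((((2 * N : ℕ) : ℝ)) : ℂ) := by push_cast; ring
  rwa [e] at h

/-- **The nome expansion of `λ/16` at the period `2N` is `Λ₁₆(q^N)`**: `qExpansion (2N) (λ/16)` is
the `N`-fold expansion of `L = qExpansion 2 (λ/16)`. [cite: CalegariDimitrovTang2025, §5.3] -/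
theorem qExpansion_modularLambda_div_sixteen_two_mul {N : ℕ} (hN : N ≠ 0) :
    qExpansion ((2 * N : ℕ) : ℝ) (fun τ : ℍ ↦ modularLambda τ / 16) =
      PowerSeries.expand N hN (qExpansion 2 (fun τ : ℍ ↦ modularLambda τ / 16)) := by
  rw [show (((2 * N : ℕ) : ℝ)) = (N : ℝ) * 2 by push_cast; ring]
  exact qExpansion_natCast_mul_eq_expand two_pos hN periodic_modularLambda_div_sixteen
    mdifferentiable_modularLambda_div_sixteen isBoundedAtImInfty_modularLambda_div_sixteen

/-- `Δ` is `n`-periodic for every natural number `n`. [cite: DiamondShurman2005, §1.1 p. 3] -/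
theorem periodic_discriminant_natCast (n : ℕ) :
    Periodic (ModularForm.discriminant ∘ ofComplex) ((n : ℝ) : ℂ) := by
  have hΓ : (n : ℝ) ∈ (𝒮ℒ).strictPeriods := by
    rw [Subgroup.strictPeriods_SL2Z, AddSubgroup.mem_zmultiples_iff]
    exact ⟨n, by simp⟩
  exact SlashInvariantFormClass.periodic_comp_ofComplex CuspForm.discriminant hΓ

/-- The constant term of `L = qExpansion 2 (λ/16)` vanishes (`λ → 0` at `i∞`: `λ/16 = q - 8q² + ⋯`).
[cite: CalegariDimitrovTang2025, §1 p. 3] -/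
theorem constantCoeff_eq_zero_of_qExpansion_modularLambda_eq {L : PowerSeries ℤ}
    (hL : qExpansion 2 (fun τ : ℍ ↦ modularLambda τ / 16) = L.map (Int.castRingHom ℂ)) :
    PowerSeries.constantCoeff L = 0 := by
  have h0 : PowerSeries.coeff 0 (qExpansion 2 (fun τ : ℍ ↦ modularLambda τ / 16)) = 0 := by
    rw [qExpansion_coeff, iteratedDeriv_zero, cuspFunction_modularLambda_zero, mul_zero]
  rw [hL, PowerSeries.coeff_map, PowerSeries.coeff_zero_eq_constantCoeff_apply, eq_intCast] at h0
  exact_mod_cast h0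

/-- **Integrality of the `q_{2N}`-expansion of `h = (λ/16)^{2m} F/Δᵐ`.**  Let `G ≤ SL(2, ℤ)` be a
finite-index subgroup containing `T^{2N}`, `F ∈ M_{12m}(G)` with rational-integer Fourier
coefficients at the period `2N`, and `L ∈ ℤ⟦q⟧` the nome expansion of `λ/16`.  Then the expansion of
`h := (λ/16)^{2m} · F/Δᵐ` in `q_{2N} = e^{πiτ/N}` has integer coefficients: from
`Δᵐ · h = (λ/16)^{2m} · F`, `qExpansion (2N) Δ = q_{2N}^{2N} · (unit of ℤ⟦q⟧)` and
`qExpansion (2N) (λ/16) = L(q_{2N}^N) ∈ q_{2N}^N ℤ⟦q_{2N}⟧`, the powers of `q_{2N}` cancel exactly.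
[cite: CalegariDimitrovTang2025, §6.3, proof of Theorem 1.0.1, with Lemma 4.2.2] -/
theorem exists_int_qExpansion_modularLambda_pow_mul_modFun {N : ℕ} (hN : 0 < N) [G.FiniteIndex]
    (hT : T ^ (2 * N) ∈ G) (F : ModularForm (G : Subgroup (GL (Fin 2) ℝ)) (12 * (m : ℤ)))
    (hF : ∀ n : ℕ, ∃ z : ℤ, PowerSeries.coeff n (qExpansion ((2 * N : ℕ) : ℝ) F) = (z : ℂ))
    {L : PowerSeries ℤ}
    (hL : qExpansion 2 (fun τ : ℍ ↦ modularLambda τ / 16) = L.map (Int.castRingHom ℂ)) :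
    ∃ H : PowerSeries ℤ, qExpansion ((2 * N : ℕ) : ℝ)
        (fun τ : ℍ ↦ (modularLambda τ / 16) ^ (2 * m) *
          (F τ / ModularForm.discriminant τ ^ m)) = H.map (Int.castRingHom ℂ) := by
  classical
  set P : ℝ := ((2 * N : ℕ) : ℝ) with hPdef
  have hP : 0 < P := by rw [hPdef]; exact_mod_cast (by omega : 0 < 2 * N)
  -- the three input functions: periodic, holomorphic, bounded at `i∞`
  have hΛper : Periodic ((fun τ : ℍ ↦ modularLambda τ / 16) ∘ ofComplex) (P : ℂ) :=
    periodic_modularLambda_div_sixteen_two_mul N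
  have hΛhol : MDiff (fun τ : ℍ ↦ modularLambda τ / 16) := mdifferentiable_modularLambda_div_sixteen
  have hΛbdd : IsBoundedAtImInfty (fun τ : ℍ ↦ modularLambda τ / 16) :=
    isBoundedAtImInfty_modularLambda_div_sixteen
  have hΓ : P ∈ ((G : Subgroup (GL (Fin 2) ℝ))).strictPeriods := mem_strictPeriods_of_T_pow_mem hT
  have hFper : Periodic ((F : ℍ → ℂ) ∘ ofComplex) (P : ℂ) :=
    SlashInvariantFormClass.periodic_comp_ofComplex F hΓ
  have hFhol : MDiff (F : ℍ → ℂ) := F.holo'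
  have hFbdd : IsBoundedAtImInfty (F : ℍ → ℂ) := ModularFormClass.bdd_at_infty F
  have hΔper : Periodic (ModularForm.discriminant ∘ ofComplex) (P : ℂ) :=
    periodic_discriminant_natCast (2 * N)
  have hΔhol : MDiff ModularForm.discriminant := CuspForm.discriminant.holo'
  have hΔbdd : IsBoundedAtImInfty ModularForm.discriminant :=
    ModularForm.discriminant_isZeroAtImInfty.isBoundedAtImInfty
  -- the function `h`
  set hf : ℍ → ℂ := fun τ : ℍ ↦ (modularLambda τ / 16) ^ (2 * m) *
    (F τ / ModularForm.discriminant τ ^ m) with hhf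
  have hhol : MDiff hf := mdifferentiable_modularLambda_pow_mul_modFun F
  have hbdd : IsBoundedAtImInfty hf := by
    simpa only [one_smul] using
      isBoundedAtImInfty_modularLambda_pow_mul_modFun_smul F (γ := 1) (fun τ ↦ by rw [one_smul])
  have hper : Periodic (hf ∘ ofComplex) (P : ℂ) := by
    intro x
    have e1 := hΛper x
    have e2 := hFper x
    have e3 := hΔper x
    simp only [Function.comp_apply] at e1 e2 e3 ⊢
    simp only [hhf]
    rw [e1, e2, e3]
  -- `Δᵐ · h = (λ/16)^{2m} · F`
  have hid : ModularForm.discriminant ^ m * hf =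
      (fun τ : ℍ ↦ modularLambda τ / 16) ^ (2 * m) * (F : ℍ → ℂ) := by
    funext τ
    have hΔ : ModularForm.discriminant τ ^ m ≠ 0 := pow_ne_zero _ (ModularForm.discriminant_ne_zero τ)
    simp only [Pi.mul_apply, Pi.pow_apply, hhf]
    field_simp
  -- take `q`-expansions at the period `P = 2N`
  have hanΛ := analyticAt_cuspFunction_zero hP hΛper hΛhol hΛbdd
  have hanF := analyticAt_cuspFunction_zero hP hFper hFhol hFbdd
  have hanΔm : AnalyticAt ℂ (cuspFunction P (ModularForm.discriminant ^ m)) 0 :=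
    analyticAt_cuspFunction_zero hP (periodic_pow_comp_ofComplex hΔper m) (hΔhol.pow m)
      (isBoundedAtImInfty_pow hΔbdd m)
  have hanΛm : AnalyticAt ℂ (cuspFunction P ((fun τ : ℍ ↦ modularLambda τ / 16) ^ (2 * m))) 0 :=
    analyticAt_cuspFunction_zero hP (periodic_pow_comp_ofComplex hΛper (2 * m)) (hΛhol.pow _)
      (isBoundedAtImInfty_pow hΛbdd _)
  have hanh := analyticAt_cuspFunction_zero hP hper hhol hbdd
  have hq := congrArg (qExpansion P) hid
  rw [qExpansion_mul hanΔm hanh, qExpansion_mul hanΛm hanF, qExpansion_pow hP hΔper hΔhol hΔbdd,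
    qExpansion_pow hP hΛper hΛhol hΛbdd] at hq
  -- the inputs: `qExpansion P Δ = X^{2N} U`, `qExpansion P (λ/16) = X^N E`, `qExpansion P F = QF`
  obtain ⟨U, hU1, hΔq⟩ :=
    exists_discriminant_qExpansion_natCast_eq_X_pow_mul (h := 2 * N) (by omega)
  have hL0 := constantCoeff_eq_zero_of_qExpansion_modularLambda_eq hL
  set L₁ : PowerSeries ℤ := PowerSeries.mk fun p ↦ PowerSeries.coeff (p + 1) L with hL₁
  have hLX : L = PowerSeries.X * L₁ := by
    have := PowerSeries.eq_X_mul_shift_add_const L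
    rwa [hL0, map_zero, add_zero] at this
  have hΛq : qExpansion P (fun τ : ℍ ↦ modularLambda τ / 16) =
      PowerSeries.X ^ N * (PowerSeries.expand N hN.ne' L₁).map (Int.castRingHom ℂ) := by
    rw [hPdef, qExpansion_modularLambda_div_sixteen_two_mul hN.ne', hL, ← PowerSeries.map_expand,
      hLX, map_mul, PowerSeries.expand_X, map_mul, map_pow, PowerSeries.map_X]
  choose z hz using hF
  set QF : PowerSeries ℤ := PowerSeries.mk z with hQF
  have hFq : qExpansion P (F : ℍ → ℂ) = QF.map (Int.castRingHom ℂ) := by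
    ext n
    rw [PowerSeries.coeff_map, hQF, PowerSeries.coeff_mk, hPdef, hz n, eq_intCast]
  rw [hΔq, hΛq, hFq] at hq
  -- cancel `X^{2Nm}`
  set Uc := U.map (Int.castRingHom ℂ) with hUc
  set E := (PowerSeries.expand N hN.ne' L₁).map (Int.castRingHom ℂ) with hE
  set QFc := QF.map (Int.castRingHom ℂ) with hQFc
  have hq' : (PowerSeries.X : PowerSeries ℂ) ^ (2 * N * m) * (Uc ^ m * qExpansion P hf) =
      PowerSeries.X ^ (2 * N * m) * (E ^ (2 * m) * QFc) := by
    rw [show (PowerSeries.X : PowerSeries ℂ) ^ (2 * N * m) * (Uc ^ m * qExpansion P hf) =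
      (PowerSeries.X ^ (2 * N) * Uc) ^ m * qExpansion P hf by rw [mul_pow, pow_mul]; ring, hq,
      mul_pow, ← pow_mul]
    ring
  have hXne : (PowerSeries.X : PowerSeries ℂ) ^ (2 * N * m) ≠ 0 := pow_ne_zero _ PowerSeries.X_ne_zero
  have hq'' := mul_left_cancel₀ hXne hq'
  -- `U` is a unit of `ℤ⟦X⟧`
  have hUunit : IsUnit U := by
    rw [PowerSeries.isUnit_iff_constantCoeff, hU1]
    exact isUnit_one
  obtain ⟨u, hu⟩ := hUunit
  refine ⟨(↑u⁻¹ : PowerSeries ℤ) ^ m * (PowerSeries.expand N hN.ne' L₁) ^ (2 * m) * QF, ?_⟩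
  have hUc1 : PowerSeries.constantCoeff Uc = 1 := by
    rw [hUc, ← PowerSeries.coeff_zero_eq_constantCoeff_apply, PowerSeries.coeff_map,
      PowerSeries.coeff_zero_eq_constantCoeff_apply, hU1, map_one]
  have hUcne : Uc ^ m ≠ 0 := by
    refine pow_ne_zero _ fun h0 ↦ ?_
    rw [h0, map_zero] at hUc1
    exact zero_ne_one hUc1
  have hUi : Uc * (↑u⁻¹ : PowerSeries ℤ).map (Int.castRingHom ℂ) = 1 := by
    rw [hUc, ← map_mul, ← hu, Units.mul_inv, map_one]
  refine mul_left_cancel₀ hUcne ?_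
  rw [hq'', map_mul, map_mul, map_pow, map_pow, ← hE, ← hQFc, ← mul_assoc, ← mul_assoc, ← mul_pow,
    hUi, one_pow, one_mul]

end UnboundedDenominators

end Literature.NumberTheory.Automorphic
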